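import Mathlib
import HarnessLib

/-!
# Counting vectors against pairs of independent vectors in a finite vector space

Topic `LinearAlgebra/Subspace`.  Elementary incidence counting in a finite vector space `V` over a
finite field `F` with `q = |F|` elements — the vector form of "points versus lines" counting in the
projective space `PG(V)`.  Everything is phrased WITHOUT new definitions: the sets involved are
`Finset`s characterised by membership hypotheses (`∀ x, x ∈ L ↔ x ∈ span F {v, w}`), so that
consumers never depend on a decidability instance.  Contents:

* `card_eq_of_mem_iff_mem_span_singleton`, `card_eq_sq_of_mem_iff_mem_span_pair` — a line through
  the origin has `q` vectors, the span of two independent vectors has `q²`;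
* `card_pairs_eq` — there are `(|V| - 1)(|V| - q)` ordered pairs `(v, w)` of independent vectors
  (`v ≠ 0`, `w ∉ span{v}`);
* `le_card_pairs_mem_span` — a non-zero vector lies in the plane `span{v, w}` of at least
  `(|V| - q)(q² - 1)` such pairs ("every point lies on the same number of lines");
* `card_pairs_mem_span_le` — two independent vectors lie together in the plane of at most
  `(q² - 1)(q² - q)` such pairs ("two points lie on one line").

The second-moment consequences (Chebyshev over pairs, the three-set cover bound used by the
matrix-multiplication summit) are in `SpanPairCover.lean`.  No named fact, no definition; standard
finite-geometry counting written for vectors (each projective count carries a factor `q - 1`).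
-/

open Submodule Finset

namespace Literature.LinearAlgebra.Subspace

section NoFintype
variable {F V : Type*} [Field F] [AddCommGroup V] [Module F V]

/-- Exchange in a plane: if `w = a • x + b • v` does not lie on the line of `v`, then `a ≠ 0` and
`x` lies in the plane of `v` and `w`. [folklore] -/
theorem mem_span_pair_of_eq_smul_add_smul {x v w : V} {a b : F} (hw : w = a • x + b • v)
    (hwv : w ∉ span F ({v} : Set V)) : a ≠ 0 ∧ x ∈ span F ({v, w} : Set V) := by
  have ha : a ≠ 0 := by
    rintro rfl
    apply hwv
    rw [hw, zero_smul, zero_add]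
    exact smul_mem _ _ (mem_span_singleton_self v)
  refine ⟨ha, ?_⟩
  rw [mem_span_pair]
  refine ⟨-(a⁻¹ * b), a⁻¹, ?_⟩
  rw [hw, smul_add, smul_smul, smul_smul, inv_mul_cancel₀ ha, one_smul]
  module

/-- The plane of two vectors of `span{v, w}` is contained in `span{v, w}` (for finsets characterised
by membership). [folklore] -/
theorem subset_of_mem_span_pair {v w x y : V} (hx : x ∈ span F ({v, w} : Set V))
    (hy : y ∈ span F ({v, w} : Set V)) (L M : Finset V)
    (hL : ∀ z, z ∈ L ↔ z ∈ span F ({v, w} : Set V))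
    (hM : ∀ z, z ∈ M ↔ z ∈ span F ({x, y} : Set V)) : M ⊆ L := by
  intro z hz
  rw [hL]
  rw [hM, mem_span_pair] at hz
  obtain ⟨a, b, rfl⟩ := hz
  exact add_mem (smul_mem _ _ hx) (smul_mem _ _ hy)

/-- The cardinality of a filtered product `(s ×ˢ t).filter P` is the sum over `a ∈ s` of the number
of `b ∈ t` with `P (a, b)`. [folklore] -/
theorem card_filter_product_eq_sum {α β : Type*} (s : Finset α) (t : Finset β)
    (P : α × β → Prop) [DecidablePred P] :
    ((s ×ˢ t).filter P).card = ∑ a ∈ s, (t.filter (fun b => P (a, b))).card := by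
  rw [card_filter, sum_product]
  refine sum_congr rfl fun a _ => ?_
  rw [card_filter]

end NoFintype

section Cards
variable {F V : Type*} [Field F] [Fintype F] [AddCommGroup V] [Module F V] [DecidableEq V]

/-- A line through the origin of a vector space over a field with `q` elements has exactly `q`
vectors: if `v ≠ 0` and `L = {x | x ∈ span{v}}` then `|L| = q`. [folklore] -/
theorem card_eq_of_mem_iff_mem_span_singleton {v : V} (hv : v ≠ 0) (L : Finset V)
    (hL : ∀ x, x ∈ L ↔ x ∈ span F ({v} : Set V)) : L.card = Fintype.card F := by
  have hLi : L = univ.image (fun t : F => t • v) := by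
    ext x
    simp only [hL, mem_span_singleton, mem_image, mem_univ, true_and]
  rw [hLi, card_image_of_injective _ (smul_left_injective F hv), card_univ]

/-- The plane spanned by two independent vectors over a field with `q` elements has exactly `q²`
vectors: if `v ≠ 0`, `w ∉ span{v}` and `L = {x | x ∈ span{v, w}}` then `|L| = q²`. [folklore] -/
theorem card_eq_sq_of_mem_iff_mem_span_pair {v w : V} (hv : v ≠ 0)
    (hw : w ∉ span F ({v} : Set V)) (L : Finset V)
    (hL : ∀ x, x ∈ L ↔ x ∈ span F ({v, w} : Set V)) : L.card = Fintype.card F ^ 2 := by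
  have hinj : Function.Injective (fun st : F × F => st.1 • v + st.2 • w) := by
    rintro ⟨s, t⟩ ⟨s', t'⟩ h
    simp only at h
    have h2 : (t - t') • w = (s' - s) • v := by linear_combination (norm := module) h
    by_cases htt : t = t'
    · subst htt
      have h3 : (s' - s) • v = 0 := by rw [← h2, sub_self, zero_smul]
      rcases smul_eq_zero.1 h3 with h4 | h4
      · exact Prod.ext (sub_eq_zero.1 h4).symm rfl
      · exact absurd h4 hv
    · exfalso
      apply hw
      have hne : t - t' ≠ 0 := sub_ne_zero.2 htt
      have : w = (t - t')⁻¹ • ((s' - s) • v) := by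
        rw [← h2, smul_smul, inv_mul_cancel₀ hne, one_smul]
      rw [this]
      exact smul_mem _ _ (smul_mem _ _ (mem_span_singleton_self v))
  have hLi : L = univ.image (fun st : F × F => st.1 • v + st.2 • w) := by
    ext x
    simp only [hL, mem_span_pair, mem_image, mem_univ, true_and, Prod.exists]
  rw [hLi, card_image_of_injective _ hinj, card_univ, Fintype.card_prod, sq]

variable [Fintype V]

/-- Vectors off a line: `|{w | w ∉ span{v}}| = |V| - q` for `v ≠ 0`. [folklore] -/
theorem card_eq_of_mem_iff_not_mem_span_singleton {v : V} (hv : v ≠ 0) (M : Finset V)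
    (hM : ∀ w, w ∈ M ↔ w ∉ span F ({v} : Set V)) :
    M.card = Fintype.card V - Fintype.card F := by
  classical
  have hMe : M = univ \ univ.filter (fun w : V => w ∈ span F ({v} : Set V)) := by
    ext w
    simp only [hM, mem_sdiff, mem_univ, mem_filter, true_and]
  rw [hMe, card_sdiff_of_subset (filter_subset _ _), card_univ,
    card_eq_of_mem_iff_mem_span_singleton (F := F) hv _ (fun x => by simp)]

/-- Vectors of a plane off one of its lines: for `x ≠ 0`, `v ∉ span{x}`,
`|{w ∈ span{x,v} | w ∉ span{v}}| = q² - q`. [folklore] -/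
theorem card_eq_of_mem_iff_mem_span_pair_not_mem {x v : V} (hx : x ≠ 0)
    (hv : v ∉ span F ({x} : Set V)) (M : Finset V)
    (hM : ∀ w, w ∈ M ↔ w ∈ span F ({x, v} : Set V) ∧ w ∉ span F ({v} : Set V)) :
    M.card = Fintype.card F ^ 2 - Fintype.card F := by
  classical
  have hv0 : v ≠ 0 := by
    rintro rfl
    exact hv (zero_mem _)
  have hsub : univ.filter (fun w : V => w ∈ span F ({v} : Set V)) ⊆
      univ.filter (fun w : V => w ∈ span F ({x, v} : Set V)) := by
    intro w hw
    simp only [mem_filter, mem_univ, true_and] at hw ⊢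
    exact span_mono (by simp) hw
  have hMe : M = univ.filter (fun w : V => w ∈ span F ({x, v} : Set V)) \
        univ.filter (fun w : V => w ∈ span F ({v} : Set V)) := by
    ext w
    simp only [hM, mem_filter, mem_univ, true_and, mem_sdiff]
  rw [hMe, card_sdiff_of_subset hsub,
    card_eq_sq_of_mem_iff_mem_span_pair (F := F) hx hv _ (fun w => by simp),
    card_eq_of_mem_iff_mem_span_singleton (F := F) hv0 _ (fun w => by simp)]

end Cards

section Pairs
variable {F V : Type*} [Field F] [Fintype F] [AddCommGroup V] [Module F V] [DecidableEq V]
  [Fintype V]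

/-- The number of ordered pairs `(v, w)` of independent vectors (`v ≠ 0`, `w ∉ span{v}`) is
`(|V| - 1)(|V| - q)`. [folklore] -/
theorem card_pairs_eq (D : Finset (V × V))
    (hD : ∀ p, p ∈ D ↔ p.1 ≠ 0 ∧ p.2 ∉ span F ({p.1} : Set V)) :
    D.card = (Fintype.card V - 1) * (Fintype.card V - Fintype.card F) := by
  classical
  have hDe : D = (univ ×ˢ univ).filter
      (fun p : V × V => p.1 ≠ 0 ∧ p.2 ∉ span F ({p.1} : Set V)) := by
    ext p
    simp only [hD, mem_filter, mem_product, mem_univ, true_and]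
  rw [hDe, card_filter_product_eq_sum]
  have hterm : ∀ v : V, (univ.filter (fun w : V => v ≠ 0 ∧ w ∉ span F ({v} : Set V))).card =
      if v = 0 then 0 else Fintype.card V - Fintype.card F := by
    intro v
    by_cases hv : v = 0
    · simp [hv]
    · rw [if_neg hv]
      exact card_eq_of_mem_iff_not_mem_span_singleton (F := F) hv _ (fun w => by simp [hv])
  simp_rw [hterm]
  rw [← Finset.add_sum_erase _ _ (mem_univ (0 : V)), if_pos rfl, zero_add,
    sum_congr rfl (fun v hv => if_neg (ne_of_mem_erase hv)), sum_const, card_erase_of_mem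
      (mem_univ _), card_univ, smul_eq_mul]

/-- First moment, fibre form: every non-zero vector `x` lies in the plane of at least
`(|V| - q)(q² - 1)` ordered pairs of independent vectors (in fact exactly that many). [folklore] -/
theorem le_card_pairs_mem_span {x : V} (hx : x ≠ 0) (D : Finset (V × V))
    (hD : ∀ p, p ∈ D ↔ p.1 ≠ 0 ∧ p.2 ∉ span F ({p.1} : Set V)) (Dx : Finset (V × V))
    (hDx : ∀ p, p ∈ Dx ↔ p ∈ D ∧ x ∈ span F ({p.1, p.2} : Set V)) :
    (Fintype.card V - Fintype.card F) * (Fintype.card F ^ 2 - 1) ≤ Dx.card := by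
  classical
  -- part A: `v` on the line of `x`
  set PA : Finset (V × V) := ((univ.filter (fun v : V => v ≠ 0 ∧ v ∈ span F ({x} : Set V))) ×ˢ
    univ).filter (fun p => p.2 ∉ span F ({p.1} : Set V)) with hPA
  -- part B: `v` off the line of `x`, `w` in the plane of `x, v` but off the line of `v`
  set PB : Finset (V × V) := ((univ.filter (fun v : V => v ∉ span F ({x} : Set V))) ×ˢ
    univ).filter (fun p => p.2 ∈ span F ({x, p.1} : Set V) ∧ p.2 ∉ span F ({p.1} : Set V))
    with hPB
  have hcardA : PA.card = (Fintype.card F - 1) * (Fintype.card V - Fintype.card F) := by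
    rw [hPA, card_filter_product_eq_sum]
    have : ∀ v ∈ univ.filter (fun v : V => v ≠ 0 ∧ v ∈ span F ({x} : Set V)),
        (univ.filter (fun w : V => w ∉ span F ({v} : Set V))).card =
          Fintype.card V - Fintype.card F := by
      intro v hv
      simp only [mem_filter, mem_univ, true_and] at hv
      exact card_eq_of_mem_iff_not_mem_span_singleton (F := F) hv.1 _ (fun w => by simp)
    rw [sum_congr rfl this, sum_const, smul_eq_mul]
    congr 1
    have he : univ.filter (fun v : V => v ≠ 0 ∧ v ∈ span F ({x} : Set V)) =
        (univ.filter (fun v : V => v ∈ span F ({x} : Set V))).erase 0 := by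
      ext v
      simp only [mem_filter, mem_univ, true_and, mem_erase]
    rw [he, card_erase_of_mem (by simp), card_eq_of_mem_iff_mem_span_singleton (F := F) hx _
      (fun v => by simp)]
  have hcardB : PB.card = (Fintype.card V - Fintype.card F) *
      (Fintype.card F ^ 2 - Fintype.card F) := by
    rw [hPB, card_filter_product_eq_sum]
    have : ∀ v ∈ univ.filter (fun v : V => v ∉ span F ({x} : Set V)),
        (univ.filter (fun w : V => w ∈ span F ({x, v} : Set V) ∧
          w ∉ span F ({v} : Set V))).card = Fintype.card F ^ 2 - Fintype.card F := by
      intro v hv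
      simp only [mem_filter, mem_univ, true_and] at hv
      exact card_eq_of_mem_iff_mem_span_pair_not_mem (F := F) hx hv _ (fun w => by simp)
    rw [sum_congr rfl this, sum_const, smul_eq_mul,
      card_eq_of_mem_iff_not_mem_span_singleton (F := F) hx _ (fun w => by simp)]
  have hdisj : Disjoint PA PB := by
    rw [Finset.disjoint_left]
    intro p hpA hpB
    rw [hPA] at hpA
    rw [hPB] at hpB
    simp only [mem_filter, mem_product, mem_univ, true_and, and_true] at hpA hpB
    exact hpB.1 hpA.1.2
  have hsub : PA ∪ PB ⊆ Dx := by
    intro p hp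
    rw [hDx, hD]
    rcases mem_union.1 hp with hpA | hpB
    · rw [hPA] at hpA
      simp only [mem_filter, mem_product, mem_univ, true_and, and_true] at hpA
      obtain ⟨⟨hv0, hvx⟩, hw⟩ := hpA
      refine ⟨⟨hv0, hw⟩, ?_⟩
      rw [mem_span_singleton] at hvx
      obtain ⟨t, ht⟩ := hvx
      have ht0 : t ≠ 0 := by
        rintro rfl
        exact hv0 (by rw [← ht, zero_smul])
      have : x = t⁻¹ • p.1 := by rw [← ht, smul_smul, inv_mul_cancel₀ ht0, one_smul]
      rw [this]
      exact smul_mem _ _ (subset_span (by simp))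
    · rw [hPB] at hpB
      simp only [mem_filter, mem_product, mem_univ, true_and, and_true] at hpB
      obtain ⟨hvx, hwxv, hwv⟩ := hpB
      have hv0 : p.1 ≠ 0 := by
        rintro h
        exact hvx (by rw [h]; exact zero_mem _)
      refine ⟨⟨hv0, hwv⟩, ?_⟩
      rw [mem_span_pair] at hwxv
      obtain ⟨a, b, hab⟩ := hwxv
      exact (mem_span_pair_of_eq_smul_add_smul hab.symm hwv).2
  calc (Fintype.card V - Fintype.card F) * (Fintype.card F ^ 2 - 1)
      = PA.card + PB.card := by
        rw [hcardA, hcardB]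
        have h1 : 1 ≤ Fintype.card F := Fintype.card_pos
        have h2 : Fintype.card F ≤ Fintype.card F ^ 2 := by nlinarith
        zify [h1, h2, le_trans h1 h2]
        ring
    _ = (PA ∪ PB).card := (card_union_of_disjoint hdisj).symm
    _ ≤ Dx.card := card_le_card hsub

/-- Two independent vectors `x, y` lie together in the plane of at most `(q² - 1)(q² - q)` ordered
pairs of independent vectors (namely the ordered bases of `span{x, y}`). [folklore] -/
theorem card_pairs_mem_span_le {x y : V} (hx : x ≠ 0) (hy : y ∉ span F ({x} : Set V))
    (D : Finset (V × V)) (hD : ∀ p, p ∈ D ↔ p.1 ≠ 0 ∧ p.2 ∉ span F ({p.1} : Set V))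
    (Dxy : Finset (V × V)) (hDxy : ∀ p, p ∈ Dxy ↔
      p ∈ D ∧ x ∈ span F ({p.1, p.2} : Set V) ∧ y ∈ span F ({p.1, p.2} : Set V)) :
    Dxy.card ≤ (Fintype.card F ^ 2 - 1) * (Fintype.card F ^ 2 - Fintype.card F) := by
  classical
  set Sxy : Finset V := univ.filter (fun z : V => z ∈ span F ({x, y} : Set V)) with hSxy
  have hScard : Sxy.card = Fintype.card F ^ 2 :=
    card_eq_sq_of_mem_iff_mem_span_pair (F := F) hx hy _ (fun z => by simp [hSxy])
  set T : Finset (V × V) := ((Sxy.filter (fun v => v ≠ 0)) ×ˢ Sxy).filter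
    (fun p => p.2 ∉ span F ({p.1} : Set V)) with hT
  have hTcard : T.card = (Fintype.card F ^ 2 - 1) * (Fintype.card F ^ 2 - Fintype.card F) := by
    rw [hT, card_filter_product_eq_sum]
    have : ∀ v ∈ Sxy.filter (fun v => v ≠ 0),
        (Sxy.filter (fun w => w ∉ span F ({v} : Set V))).card =
          Fintype.card F ^ 2 - Fintype.card F := by
      intro v hv
      simp only [hSxy, mem_filter, mem_univ, true_and] at hv
      have he : Sxy.filter (fun w => w ∉ span F ({v} : Set V)) =
          Sxy \ univ.filter (fun w : V => w ∈ span F ({v} : Set V)) := by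
        ext w
        simp only [mem_filter, mem_sdiff, mem_univ, true_and]
      have hsub : univ.filter (fun w : V => w ∈ span F ({v} : Set V)) ⊆ Sxy := by
        intro w hw
        simp only [hSxy, mem_filter, mem_univ, true_and] at hw ⊢
        exact (span_singleton_le_iff_mem v _).2 hv.1 hw
      rw [he, card_sdiff_of_subset hsub, hScard,
        card_eq_of_mem_iff_mem_span_singleton (F := F) hv.2 _ (fun w => by simp)]
    rw [sum_congr rfl this, sum_const, smul_eq_mul]
    congr 1
    have : Sxy.filter (fun v => v ≠ 0) = Sxy.erase 0 := by
      ext v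
      simp only [mem_filter, mem_erase, ne_eq]
      tauto
    rw [this, card_erase_of_mem (by simp [hSxy]), hScard]
  have hsub : Dxy ⊆ T := by
    intro p hp
    rw [hDxy, hD] at hp
    obtain ⟨⟨hv0, hwv⟩, hxp, hyp⟩ := hp
    set L : Finset V := univ.filter (fun z : V => z ∈ span F ({p.1, p.2} : Set V)) with hL
    have hLcard : L.card = Fintype.card F ^ 2 :=
      card_eq_sq_of_mem_iff_mem_span_pair (F := F) hv0 hwv _ (fun z => by simp [hL])
    have hSL : Sxy ⊆ L :=
      subset_of_mem_span_pair hxp hyp L Sxy (fun z => by simp [hL]) (fun z => by simp [hSxy])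
    have hEq : Sxy = L := eq_of_subset_of_card_le hSL (by rw [hLcard, hScard])
    have hv : p.1 ∈ Sxy := by
      rw [hEq]; simp only [hL, mem_filter, mem_univ, true_and]
      exact subset_span (by simp)
    have hw : p.2 ∈ Sxy := by
      rw [hEq]; simp only [hL, mem_filter, mem_univ, true_and]
      exact subset_span (by simp)
    rw [hT]
    simp only [mem_filter, mem_product]
    exact ⟨⟨⟨hv, hv0⟩, hw⟩, hwv⟩
  exact (card_le_card hsub).trans hTcard.le

end Pairs
end Literature.LinearAlgebra.Subspace
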